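import Literature.Analysis.InnerProduct.LensSpaceIsospectralRigidityPrime
import HarnessLib

/-!
# Ikeda–Yamamoto's Main Theorem for twice a prime: two isospectral three-dimensional lens spaces `L(q; p₁, p₂)`,
# `L(q; p₁', p₂')` with `q = 2l`, `l` an odd prime, are isometric (Ikeda–Yamamoto 1979, §8, case (8.1))

Layer `Literature/Analysis/InnerProduct`, namespace `Literature.Analysis.InnerProduct`; lane `lit-hodgefound`, prover seat
`lit-hodgefound-p06`, generation 45, row g45-#4. THEOREMS only (no definition, no instance, no notation, no named fact). The
companion `LensSpaceIsospectralRigidityPrime.lean` (row g45-#2) proves the Main Theorem for `q = l` an odd prime; this file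
does `q = 2l` — the case `ν = 1` of the source's second family `q = 2l^ν` — and packages both as the Main Theorem for
`q ∈ {l, 2l}` (the orders for which M. Tanaka had announced the result, Remark of the Introduction).

## Source, verbatim (held text `paper:doi-10-18910-4811`)

A. Ikeda, Y. Yamamoto, *On the spectra of 3-dimensional lens spaces*, Osaka J. Math. **16** (1979) 447–469, §8 (p. 463–464):
"**8. Proof of Main Theorem for `q = 2l^ν` (`l` is an odd prime and `ν ≥ 1`).** First, we consider the case (8.1)
`(p₁ + 1, q) = (p₁ − 1, q) = 2`. Since `k = 1` satisfies (4.13) and (4.14), by Corollary 4.7, we have (8.2)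
`cot(π/q₀)(p₁+1)/2 − cot(π/q₀)(p₁−1)/2 + cot(π/q₀)(p₁*+1)/2 − cot(π/q₀)(p₁*−1)/2 − cot(π/q₀)(p₂+1)/2 + cot(π/q₀)(p₂−1)/2 −
cot(π/q₀)(p₂*+1)/2 + cot(π/q₀)(p₂*−1)/2 = 0`, where `q₀ = l^ν`. By (8.1), Lemma 4.2 and Lemma 4.4, all the integers
`(p₁ ± 1)/2`, `(p₁* ± 1)/2`, `(p₂ ± 1)/2` and `(p₂* ± 1)/2` are prime to `q₀`. Applying Lemma 5.3 to (8.2), in the same way as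
in 6, we see either `p₁ ≡ ±p₂ (mod q₀)` or `p₁ ≡ ±p₂* (mod q₀)`. Since all the integers `p₁, p₁*, p₂` and `p₂*` must be odd,
we have either `p₁ ≡ ±p₂ (mod q)` or `p₁ ≡ ±p₂* (mod q)`, which proves our Main Theorem in this case." Introduction (p. 448):
"REMARK. Tanaka announced in his paper [10] that he obtained the above main theorem for `q =` odd primes and 2-times odd
primes."

## The proof, as formalised (`q = 2l`, `q₀ = l`)

For `q = 2l` every weight prime to `q` is odd, and a non-homogeneous weight `p ≢ ±1 (mod 2l)` satisfies (8.1) automatically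
(`2 ∣ p ± 1`, and `2l ∣ p ± 1` iff `l ∣ p ± 1`); the homogeneous case is Corollary 3.4 (the tree's
`dvd_sub_or_dvd_add_of_lensMultiplicity_eq`), exactly as for prime `q`. In the generic case Corollary 4.7 with `k = 1` (the
tree's `cot_alternatingSum_eq_of_lensMultiplicity_eq`, row g45-#1) gives (4.18) for the modulus `2l`; each of its eight
arguments `a = p ± 1, p* ± 1` is even, and `cot(πa/2l) = cot(π(a/2)/l)` (`cot_mul_div_two_mul`) turns (4.18) into the relation
(8.2) for the modulus `l` between the cotangents at the points `h(P ± 1)`, `h(U ± 1)`, `h(Q ± 1)`, `h(V ± 1)` of `ℤ/l`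
(`P = p₁`, `U = p₁*`, `Q = p₂`, `V = p₂*`, `h = 2⁻¹ ∈ ℤ/l`), all units. §1 generalizes the combinatorial core of row g45-#2 to
points scaled by a unit `c` (`classCount_sub_classCount_add_two_smul`, `eq_or_eq_neg_of_cot_relation_smul`: read the vanishing
signed indicator at `x = c(y + 1)`; the multiplicity function of the class `{±P, ±U}` is again `2`-periodic, hence constant on
`ℤ/l`, hence equal to that of `{±Q, ±V}`), so "in the same way as in 6" `p₂ ≡ ±p₁` or `p₂ ≡ ±p₁* (mod l)`; since all four are
odd the congruences lift to `mod 2l` (`dvd_of_lensMultiplicity_one_eq_of_twice_prime`). §3 packages the general weights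
(`dvd_of_lensMultiplicity_eq_of_twice_prime`), the equivalence with Ikeda's isometry criterion
(`lensMultiplicity_eq_iff_lensWeightsEquivalent_of_twice_prime`), and THE MAIN THEOREM FOR `q ∈ {l, 2l}`
(`lensMultiplicity_eq_iff_lensWeightsEquivalent_of_prime_or_twice_prime`).

## References

* [IkedaYamamoto1979] A. Ikeda, Y. Yamamoto, *On the spectra of 3-dimensional lens spaces*, Osaka J. Math. 16 (1979) 447–469:
  Main Theorem, §8 (8.1)–(8.2), Lemma 5.3, Corollary 4.7, Proposition 4.1, Remark of the Introduction.
* [Okada1981] T. Okada, *On an extension of a theorem of S. Chowla*, Acta Arith. 38 (1980/81) 341–345 (Lemma 5.3).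
* [Ikeda1980] A. Ikeda, *On lens spaces which are isospectral but not isometric*, Ann. Sci. ÉNS (4) 13 (1980) 303–315,
  Theorem 2.1 (the isometry criterion `LensWeightsEquivalent`).
-/

noncomputable section

open Finset Filter Topology Complex

namespace Literature.Analysis.InnerProduct

open _root_.Real _root_.Filter _root_.Topology

/-! ### §1 The combinatorial core of §6 for points scaled by a unit `c` of `ℤ/m` -/

/-- The eight memberships at `x = c(y + 1)` for points `c(t ± 1)`, `c` a unit: `c(y+1) = ±c(t±1)` iff `y = t`, `y + 2 = −t`,
`y + 2 = t`, `y = −t` respectively. [folklore] -/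
private theorem smul_shift_iffs {R : Type*} [CommRing R] {c : R} (hc : IsUnit c) (y t : R) :
    (c * (y + 1) = c * (t + 1) ↔ y = t) ∧ (c * (y + 1) = -(c * (t + 1)) ↔ y + 2 = -t) ∧
      (c * (y + 1) = c * (t - 1) ↔ y + 2 = t) ∧ (c * (y + 1) = -(c * (t - 1)) ↔ y = -t) := by
  refine ⟨?_, ?_, ?_, ?_⟩
  · rw [hc.mul_right_inj]
    exact ⟨fun h ↦ by linear_combination h, fun h ↦ by linear_combination h⟩
  · rw [← mul_neg, hc.mul_right_inj]
    exact ⟨fun h ↦ by linear_combination h, fun h ↦ by linear_combination h⟩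
  · rw [hc.mul_right_inj]
    exact ⟨fun h ↦ by linear_combination h, fun h ↦ by linear_combination h⟩
  · rw [← mul_neg, hc.mul_right_inj]
    exact ⟨fun h ↦ by linear_combination h, fun h ↦ by linear_combination h⟩

/-- **The vanishing signed indicator of (8.2), read at `x = c(y + 1)`** — the scaled form of
`classCount_sub_classCount_add_two`: if `c` is a unit of `ℤ/m` (`m ≥ 3`), the eight points `c(P ± 1)`, `c(U ± 1)`, `c(Q ± 1)`,
`c(V ± 1)` are units and their cotangents satisfy the relation (8.2) (= (4.18) at the halved arguments, `c = 2⁻¹`), then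
`N_{P,U}(y) − N_{P,U}(y + 2) = N_{Q,V}(y) − N_{Q,V}(y + 2)` for all `y`, `N_{P,U}(y) = [y = P] + [y = −P] + [y = U] + [y = −U]`.
[cite: IkedaYamamoto1979, §8 ("Applying Lemma 5.3 to (8.2), in the same way as in 6"), Lemma 5.3] -/
theorem classCount_sub_classCount_add_two_smul {m : ℕ} [NeZero m] (hm : 2 < m) {c P U Q V : ZMod m} (hc : IsUnit c)
    (hP1 : IsUnit (c * (P + 1))) (hP2 : IsUnit (c * (P - 1))) (hU1 : IsUnit (c * (U + 1))) (hU2 : IsUnit (c * (U - 1)))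
    (hQ1 : IsUnit (c * (Q + 1))) (hQ2 : IsUnit (c * (Q - 1))) (hV1 : IsUnit (c * (V + 1))) (hV2 : IsUnit (c * (V - 1)))
    (hrel : Complex.cot (π * ((c * (P + 1)).val : ℂ) / m) - Complex.cot (π * ((c * (P - 1)).val : ℂ) / m) +
        (Complex.cot (π * ((c * (U + 1)).val : ℂ) / m) - Complex.cot (π * ((c * (U - 1)).val : ℂ) / m)) =
      Complex.cot (π * ((c * (Q + 1)).val : ℂ) / m) - Complex.cot (π * ((c * (Q - 1)).val : ℂ) / m) +
        (Complex.cot (π * ((c * (V + 1)).val : ℂ) / m) - Complex.cot (π * ((c * (V - 1)).val : ℂ) / m)))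
    (y : ZMod m) :
    ((if y = P then (1 : ℤ) else 0) + (if y = -P then 1 else 0) + (if y = U then 1 else 0) + (if y = -U then 1 else 0)) -
      ((if y + 2 = P then (1 : ℤ) else 0) + (if y + 2 = -P then 1 else 0) + (if y + 2 = U then 1 else 0) +
        (if y + 2 = -U then 1 else 0)) =
    ((if y = Q then (1 : ℤ) else 0) + (if y = -Q then 1 else 0) + (if y = V then 1 else 0) + (if y = -V then 1 else 0)) -
      ((if y + 2 = Q then (1 : ℤ) else 0) + (if y + 2 = -Q then 1 else 0) + (if y + 2 = V then 1 else 0) +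
        (if y + 2 = -V then 1 else 0)) := by
  classical
  have h := sum_signedIndicator_eq_zero_of_sum_mul_cot_eq_zero hm
    ![c * (P + 1), c * (P - 1), c * (U + 1), c * (U - 1), c * (Q + 1), c * (Q - 1), c * (V + 1), c * (V - 1)]
    (by intro i; fin_cases i <;> assumption) ![1, -1, 1, -1, -1, 1, -1, 1]
    (by simp only [Fin.sum_univ_eight, Matrix.cons_val]; push_cast; linear_combination hrel) (c * (y + 1))
  simp only [Fin.sum_univ_eight, Matrix.cons_val] at h
  obtain ⟨aP, bP, cP, dP⟩ := smul_shift_iffs hc y P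
  obtain ⟨aU, bU, cU, dU⟩ := smul_shift_iffs hc y U
  obtain ⟨aQ, bQ, cQ, dQ⟩ := smul_shift_iffs hc y Q
  obtain ⟨aV, bV, cV, dV⟩ := smul_shift_iffs hc y V
  simp only [aP, bP, cP, dP, aU, bU, cU, dU, aQ, bQ, cQ, dQ, aV, bV, cV, dV] at h
  linear_combination h

/-- A `2`-periodic function on `ℤ/m`, `2` a unit, is constant. [folklore] -/
private theorem eq_apply_zero_of_forall_apply_add_two' {m : ℕ} [NeZero m] {M : Type*} (h2 : IsUnit (2 : ZMod m))
    {D : ZMod m → M} (hD : ∀ y, D (y + 2) = D y) (y : ZMod m) : D y = D 0 := by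
  have hn : ∀ n : ℕ, D (2 * (n : ZMod m)) = D 0 := by
    intro n
    induction n with
    | zero => simp
    | succ n ih => rw [show (2 : ZMod m) * ((n + 1 : ℕ) : ZMod m) = 2 * (n : ZMod m) + 2 by push_cast; ring, hD, ih]
  obtain ⟨w, hw⟩ := h2
  have hy : y = 2 * (((↑w⁻¹ : ZMod m) * y).val : ZMod m) := by
    rw [ZMod.natCast_zmod_val, ← mul_assoc, ← hw, Units.mul_inv, one_mul]
  rw [hy]
  exact hn _

/-- **"In the same way as in 6", for scaled points**: let `m ≥ 3` with `2` invertible mod `m`, `c` a unit of `ℤ/m`, and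
`P, U, Q, V` non-zero with the eight points `c(P ± 1)`, …, `c(V ± 1)` units satisfying the relation (8.2). Then
`Q ∈ {P, −P, U, −U}`. [cite: IkedaYamamoto1979, §8 ("we see either `p₁ ≡ ±p₂ (mod q₀)` or `p₁ ≡ ±p₂* (mod q₀)`"), §6] -/
theorem eq_or_eq_neg_of_cot_relation_smul {m : ℕ} [NeZero m] (hm : 2 < m) (h2 : IsUnit (2 : ZMod m)) {c P U Q V : ZMod m}
    (hc : IsUnit c) (hP0 : P ≠ 0) (hU0 : U ≠ 0) (hQ0 : Q ≠ 0) (hV0 : V ≠ 0)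
    (hP1 : IsUnit (c * (P + 1))) (hP2 : IsUnit (c * (P - 1))) (hU1 : IsUnit (c * (U + 1))) (hU2 : IsUnit (c * (U - 1)))
    (hQ1 : IsUnit (c * (Q + 1))) (hQ2 : IsUnit (c * (Q - 1))) (hV1 : IsUnit (c * (V + 1))) (hV2 : IsUnit (c * (V - 1)))
    (hrel : Complex.cot (π * ((c * (P + 1)).val : ℂ) / m) - Complex.cot (π * ((c * (P - 1)).val : ℂ) / m) +
        (Complex.cot (π * ((c * (U + 1)).val : ℂ) / m) - Complex.cot (π * ((c * (U - 1)).val : ℂ) / m)) =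
      Complex.cot (π * ((c * (Q + 1)).val : ℂ) / m) - Complex.cot (π * ((c * (Q - 1)).val : ℂ) / m) +
        (Complex.cot (π * ((c * (V + 1)).val : ℂ) / m) - Complex.cot (π * ((c * (V - 1)).val : ℂ) / m))) :
    Q = P ∨ Q = -P ∨ Q = U ∨ Q = -U := by
  classical
  have hper := classCount_sub_classCount_add_two_smul hm hc hP1 hP2 hU1 hU2 hQ1 hQ2 hV1 hV2 hrel
  have hD := eq_apply_zero_of_forall_apply_add_two' (m := m) h2
    (D := fun y : ZMod m ↦ ((if y = P then (1 : ℤ) else 0) + (if y = -P then 1 else 0) + (if y = U then 1 else 0) +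
        (if y = -U then 1 else 0)) -
      ((if y = Q then (1 : ℤ) else 0) + (if y = -Q then 1 else 0) + (if y = V then 1 else 0) + (if y = -V then 1 else 0)))
    (fun y ↦ by linear_combination -(hper y))
  have hD0 : ((if (0 : ZMod m) = P then (1 : ℤ) else 0) + (if (0 : ZMod m) = -P then 1 else 0) +
        (if (0 : ZMod m) = U then 1 else 0) + (if (0 : ZMod m) = -U then 1 else 0)) -
      ((if (0 : ZMod m) = Q then (1 : ℤ) else 0) + (if (0 : ZMod m) = -Q then 1 else 0) +
        (if (0 : ZMod m) = V then 1 else 0) + (if (0 : ZMod m) = -V then 1 else 0)) = 0 := by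
    rw [if_neg (fun h ↦ hP0 h.symm), if_neg (fun h ↦ hP0 (neg_eq_zero.mp h.symm)), if_neg (fun h ↦ hU0 h.symm),
      if_neg (fun h ↦ hU0 (neg_eq_zero.mp h.symm)), if_neg (fun h ↦ hQ0 h.symm),
      if_neg (fun h ↦ hQ0 (neg_eq_zero.mp h.symm)), if_neg (fun h ↦ hV0 h.symm),
      if_neg (fun h ↦ hV0 (neg_eq_zero.mp h.symm))]
    norm_num
  refine eq_or_eq_neg_of_classCount_eq (V := V) fun y ↦ ?_
  have e := hD y
  rw [hD0] at e
  linear_combination e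

/-! ### §2 Halving the arguments: `cot(πa/2l) = cot(π(a/2)/l)` for even `a`, as a cotangent at a point of `ℤ/l` -/

/-- `cot(πt/l) = cot(πt̃/l)` with `t̃ ∈ [0, l)` the representative of `t mod l`. [folklore] -/
private theorem cot_intCast_eq_cot_val' {l : ℕ} [NeZero l] (t : ℤ) :
    Complex.cot (π * t / l) = Complex.cot (π * (((t : ZMod l).val : ℕ) : ℂ) / l) := by
  have hl : (l : ℂ) ≠ 0 := Nat.cast_ne_zero.mpr (NeZero.ne l)
  obtain ⟨m, hm⟩ : (l : ℤ) ∣ t - (((t : ZMod l).val : ℕ) : ℤ) := by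
    rw [← ZMod.intCast_zmod_eq_zero_iff_dvd]
    push_cast
    rw [ZMod.natCast_zmod_val, sub_self]
  have he : cexp (2 * π * I * t / l) = cexp (2 * π * I * ((((t : ZMod l).val : ℕ) : ℤ) : ℂ) / l) := by
    rw [Complex.exp_eq_exp_iff_exists_int]
    refine ⟨m, ?_⟩
    have ht : (t : ℂ) = ((((t : ZMod l).val : ℕ) : ℤ) : ℂ) + (l : ℂ) * (m : ℂ) := by
      exact_mod_cast (show t = (((t : ZMod l).val : ℕ) : ℤ) + l * m by linear_combination hm)
    rw [ht]
    field_simp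
  have h1 := I_mul_cot_eq_ratio l t
  have h2 := I_mul_cot_eq_ratio l ((((t : ZMod l).val : ℕ) : ℤ))
  rw [he] at h1
  push_cast at h1 h2
  exact mul_left_cancel₀ I_ne_zero (h1.trans h2.symm)

/-- **Halving**: for an even integer `a` and `2h ≡ 1 (mod l)`, `cot(πa/2l) = cot(π·(h·a)~/l)` — the passage from (4.18) for
the modulus `q = 2l` to (8.2) for the modulus `q₀ = l` ("`cot(π/q₀)(p₁+1)/2`", …). [cite: IkedaYamamoto1979, §8 (8.2)] -/
theorem cot_mul_div_two_mul {l : ℕ} [NeZero l] {h : ZMod l} (hh : h * 2 = 1) {a : ℤ} (ha : 2 ∣ a) :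
    Complex.cot (π * a / (2 * l : ℕ)) = Complex.cot (π * (((h * (a : ZMod l)).val : ℕ) : ℂ) / l) := by
  obtain ⟨b, rfl⟩ := ha
  have hl : (l : ℂ) ≠ 0 := Nat.cast_ne_zero.mpr (NeZero.ne l)
  have e1 : (π : ℂ) * ((2 * b : ℤ) : ℂ) / ((2 * l : ℕ) : ℂ) = π * (b : ℂ) / l := by
    push_cast
    field_simp
  have e2 : h * ((2 * b : ℤ) : ZMod l) = (b : ZMod l) := by
    push_cast
    linear_combination (b : ZMod l) * hh
  rw [e1, e2]
  exact cot_intCast_eq_cot_val' b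

/-! ### §3 THE MAIN THEOREM for `q = 2l`, `l` an odd prime -/

/-- `q ∤ t ⇒ t ≠ 0` in `ℤ/q`. [folklore] -/
private theorem cast_ne_zero_of_not_dvd' {q : ℕ} {t : ℤ} (ht : ¬ (q : ℤ) ∣ t) : (t : ZMod q) ≠ 0 :=
  fun h0 ↦ ht ((ZMod.intCast_zmod_eq_zero_iff_dvd _ _).mp h0)

/-- `pp* ≡ 1 (mod q)` read in `ℤ/q`. [folklore] -/
private theorem cast_mul_cast_eq_one'' {q : ℕ} {p u : ℤ} (hu : (q : ℤ) ∣ u * p - 1) :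
    (u : ZMod q) * (p : ZMod q) = 1 := by
  have h := (ZMod.intCast_zmod_eq_zero_iff_dvd (u * p - 1) q).mpr hu
  push_cast at h
  exact sub_eq_zero.mp h

/-- A weight prime to `2l` is odd. [folklore] -/
private theorem odd_of_isCoprime_two_mul {l : ℕ} {p : ℤ} (hp : IsCoprime p ((2 * l : ℕ) : ℤ)) : Odd p := by
  rw [← Int.not_even_iff_odd]
  rintro ⟨c, rfl⟩
  obtain ⟨a, b, hab⟩ := hp
  push_cast at hab
  have : (2 : ℤ) ∣ 1 := ⟨a * c + b * l, by linear_combination -hab⟩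
  omega

/-- For odd `t`: `2l ∣ t ± 1 ↔ l ∣ t ± 1`; phrased as `¬ 2l ∣ s ⇒ ¬ l ∣ s` for even `s`, `l` odd. [folklore] -/
private theorem not_dvd_of_not_two_mul_dvd {l : ℕ} (hl : Odd l) {s : ℤ} (hs : 2 ∣ s) (h : ¬ ((2 * l : ℕ) : ℤ) ∣ s) :
    ¬ (l : ℤ) ∣ s := by
  intro hd
  apply h
  push_cast
  have hcop : IsCoprime (2 : ℤ) (l : ℤ) := by
    rw [show (2 : ℤ) = ((2 : ℕ) : ℤ) by norm_num, Nat.isCoprime_iff_coprime]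
    exact Nat.coprime_two_left.mpr hl
  exact hcop.mul_dvd hs hd

/-- Lifting congruences from `l` to `2l` for even numbers. [folklore] -/
private theorem two_mul_dvd_of_dvd {l : ℕ} (hl : Odd l) {s : ℤ} (hs : 2 ∣ s) (hd : (l : ℤ) ∣ s) :
    ((2 * l : ℕ) : ℤ) ∣ s := by
  push_cast
  have hcop : IsCoprime (2 : ℤ) (l : ℤ) := by
    rw [show (2 : ℤ) = ((2 : ℕ) : ℤ) by norm_num, Nat.isCoprime_iff_coprime]
    exact Nat.coprime_two_left.mpr hl
  exact hcop.mul_dvd hs hd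

/-- **MAIN THEOREM (Ikeda–Yamamoto 1979) for `q = 2l`, `l` an odd prime, normalized weights.** If `L(2l; 1, p₁)` and
`L(2l; 1, p₂)` (`pᵢ` prime to `2l`) are isospectral — `dim E_{n(n+2)}` agree for all `n` — then `p₁ ≡ ±p₂ (mod 2l)` or
`p₁p₂ ≡ ±1 (mod 2l)` (so, by Proposition 4.1, the two lens spaces are isometric). Proof = §8, case (8.1), with `q₀ = l`:
homogeneous weights by Corollary 3.4; otherwise (4.18) with `k = 1` for the modulus `2l`, halved to (8.2) for the modulus
`l`, Lemma 5.3 (Chowla–Okada) and the combinatorics of §6 give the congruences mod `l`, which lift to mod `2l` because all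
of `p₁, p₁*, p₂, p₂*` are odd. [cite: IkedaYamamoto1979, Main Theorem (`q = 2l`), §8 (8.1)–(8.2), Proposition 4.1] -/
theorem dvd_of_lensMultiplicity_one_eq_of_twice_prime {l : ℕ} [hl : Fact l.Prime] (hl2 : l ≠ 2) {p₁ p₂ : ℤ}
    (hp₁ : IsCoprime p₁ ((2 * l : ℕ) : ℤ)) (hp₂ : IsCoprime p₂ ((2 * l : ℕ) : ℤ))
    (h : ∀ n : ℕ, lensMultiplicity (2 * l) 1 p₁ n = lensMultiplicity (2 * l) 1 p₂ n) :
    ((2 * l : ℕ) : ℤ) ∣ p₁ - p₂ ∨ ((2 * l : ℕ) : ℤ) ∣ p₁ + p₂ ∨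
      ((2 * l : ℕ) : ℤ) ∣ p₁ * p₂ - 1 ∨ ((2 * l : ℕ) : ℤ) ∣ p₁ * p₂ + 1 := by
  haveI : NeZero l := ⟨hl.out.ne_zero⟩
  haveI : NeZero (2 * l) := ⟨by have := hl.out.pos; omega⟩
  have hl3 : 2 < l := by have := hl.out.two_le; omega
  have hlodd : Odd l := hl.out.odd_of_ne_two hl2
  have h1cop : IsCoprime (1 : ℤ) ((2 * l : ℕ) : ℤ) := isCoprime_one_left
  -- the homogeneous case: COROLLARY 3.4
  have hom : ∀ {a b : ℤ}, IsCoprime b ((2 * l : ℕ) : ℤ) →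
      (∀ n : ℕ, lensMultiplicity (2 * l) 1 a n = lensMultiplicity (2 * l) 1 b n) →
      (((2 * l : ℕ) : ℤ) ∣ a - 1 ∨ ((2 * l : ℕ) : ℤ) ∣ a + 1) →
      ((2 * l : ℕ) : ℤ) ∣ a - b ∨ ((2 * l : ℕ) : ℤ) ∣ a + b := by
    intro a b hb hab hhom
    have hhom' : ((2 * l : ℕ) : ℤ) ∣ 1 - a ∨ ((2 * l : ℕ) : ℤ) ∣ 1 + a := by
      rcases hhom with hh | hh
      · exact Or.inl (by rw [← dvd_neg, neg_sub]; exact hh)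
      · exact Or.inr (by rwa [add_comm])
    rcases dvd_sub_or_dvd_add_of_lensMultiplicity_eq (2 * l) h1cop h1cop hb hhom' hab with hb' | hb'
    · rcases hhom with hh | hh
      · left; have := dvd_add hh hb'; rwa [show a - 1 + (1 - b) = a - b by ring] at this
      · right; have := dvd_sub hh hb'; rwa [show a + 1 - (1 - b) = a + b by ring] at this
    · rcases hhom with hh | hh
      · right; have := dvd_add hh hb'; rwa [show a - 1 + (1 + b) = a + b by ring] at this
      · left; have := dvd_sub hh hb'; rwa [show a + 1 - (1 + b) = a - b by ring] at this
  by_cases hhom₁ : ((2 * l : ℕ) : ℤ) ∣ p₁ - 1 ∨ ((2 * l : ℕ) : ℤ) ∣ p₁ + 1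
  · rcases hom hp₂ h hhom₁ with h' | h'
    · exact Or.inl h'
    · exact Or.inr (Or.inl h')
  by_cases hhom₂ : ((2 * l : ℕ) : ℤ) ∣ p₂ - 1 ∨ ((2 * l : ℕ) : ℤ) ∣ p₂ + 1
  · rcases hom hp₁ (fun n ↦ (h n).symm) hhom₂ with h' | h'
    · exact Or.inl (by rw [← dvd_neg, neg_sub]; exact h')
    · exact Or.inr (Or.inl (by rwa [add_comm]))
  -- the generic case (8.1): (4.18) with `k = 1` for the modulus `2l`
  rw [not_or] at hhom₁ hhom₂
  have hodd₁ := odd_of_isCoprime_two_mul hp₁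
  have hodd₂ := odd_of_isCoprime_two_mul hp₂
  obtain ⟨u₁, b₁, hub₁⟩ := hp₁
  obtain ⟨u₂, b₂, hub₂⟩ := hp₂
  have hu₁ : ((2 * l : ℕ) : ℤ) ∣ u₁ * p₁ - 1 := ⟨-b₁, by linear_combination hub₁⟩
  have hu₂ : ((2 * l : ℕ) : ℤ) ∣ u₂ * p₂ - 1 := ⟨-b₂, by linear_combination hub₂⟩
  have hoddu₁ : Odd u₁ := by
    have : Odd (u₁ * p₁) := by
      obtain ⟨c, hc⟩ := hu₁
      exact ⟨c * l, by push_cast at hc; linear_combination hc⟩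
    exact (Int.odd_mul.mp this).1
  have hoddu₂ : Odd u₂ := by
    have : Odd (u₂ * p₂) := by
      obtain ⟨c, hc⟩ := hu₂
      exact ⟨c * l, by push_cast at hc; linear_combination hc⟩
    exact (Int.odd_mul.mp this).1
  have h2 : ¬ ((2 * l : ℕ) : ℤ) ∣ 2 * 1 := by
    intro hd
    have := Int.le_of_dvd (by norm_num) hd
    push_cast at this
    have : (2 : ℤ) < l := by exact_mod_cast hl3
    omega
  have hrel := cot_alternatingSum_eq_of_lensMultiplicity_eq (q := 2 * l) (k := 1) hu₁ hu₂ h2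
    (by rw [one_mul]; exact hhom₁.1) (by rw [one_mul]; exact hhom₁.2) (by rw [one_mul]; exact hhom₂.1)
    (by rw [one_mul]; exact hhom₂.2) h
  -- halving: to the modulus `l` and the points `h(P ± 1)`, …
  have hl2' : (2 : ZMod l) ≠ 0 := by
    intro h0
    have : ((2 : ℤ) : ZMod l) = 0 := by exact_mod_cast h0
    have hd := (ZMod.intCast_zmod_eq_zero_iff_dvd 2 l).mp this
    have := Int.le_of_dvd two_pos hd
    have : (2 : ℤ) < l := by exact_mod_cast hl3
    omega
  have h2u : IsUnit (2 : ZMod l) := isUnit_iff_ne_zero.mpr hl2'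
  set c : ZMod l := (2 : ZMod l)⁻¹ with hc
  have hc2 : c * 2 = 1 := inv_mul_cancel₀ hl2'
  have hcu : IsUnit c := isUnit_iff_ne_zero.mpr (inv_ne_zero hl2')
  have ev : ∀ {t : ℤ}, Odd t → (2 : ℤ) ∣ 1 * (t + 1) ∧ (2 : ℤ) ∣ 1 * (t - 1) := fun ht ↦ by
    obtain ⟨r, rfl⟩ := ht
    exact ⟨⟨r + 1, by ring⟩, ⟨r, by ring⟩⟩
  rw [cot_mul_div_two_mul hc2 (ev hodd₁).1, cot_mul_div_two_mul hc2 (ev hodd₁).2, cot_mul_div_two_mul hc2 (ev hoddu₁).1,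
    cot_mul_div_two_mul hc2 (ev hoddu₁).2, cot_mul_div_two_mul hc2 (ev hodd₂).1, cot_mul_div_two_mul hc2 (ev hodd₂).2,
    cot_mul_div_two_mul hc2 (ev hoddu₂).1, cot_mul_div_two_mul hc2 (ev hoddu₂).2] at hrel
  have c1 : c * ((1 * (p₁ + 1) : ℤ) : ZMod l) = c * ((p₁ : ZMod l) + 1) := by push_cast; ring
  have c2 : c * ((1 * (p₁ - 1) : ℤ) : ZMod l) = c * ((p₁ : ZMod l) - 1) := by push_cast; ring
  have c3 : c * ((1 * (u₁ + 1) : ℤ) : ZMod l) = c * ((u₁ : ZMod l) + 1) := by push_cast; ring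
  have c4 : c * ((1 * (u₁ - 1) : ℤ) : ZMod l) = c * ((u₁ : ZMod l) - 1) := by push_cast; ring
  have c5 : c * ((1 * (p₂ + 1) : ℤ) : ZMod l) = c * ((p₂ : ZMod l) + 1) := by push_cast; ring
  have c6 : c * ((1 * (p₂ - 1) : ℤ) : ZMod l) = c * ((p₂ : ZMod l) - 1) := by push_cast; ring
  have c7 : c * ((1 * (u₂ + 1) : ℤ) : ZMod l) = c * ((u₂ : ZMod l) + 1) := by push_cast; ring
  have c8 : c * ((1 * (u₂ - 1) : ℤ) : ZMod l) = c * ((u₂ : ZMod l) - 1) := by push_cast; ring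
  rw [c1, c2, c3, c4, c5, c6, c7, c8] at hrel
  -- the hypotheses of the combinatorial core, in the field `ℤ/l`
  have hl2l : (l : ℤ) ∣ ((2 * l : ℕ) : ℤ) := Dvd.intro_left 2 (by push_cast; ring)
  have hu₁' : (l : ℤ) ∣ u₁ * p₁ - 1 := hl2l.trans hu₁
  have hu₂' : (l : ℤ) ∣ u₂ * p₂ - 1 := hl2l.trans hu₂
  have hUP := cast_mul_cast_eq_one'' hu₁'
  have hVQ := cast_mul_cast_eq_one'' hu₂'
  have nd : ∀ {t : ℤ}, Odd t → ¬ ((2 * l : ℕ) : ℤ) ∣ t - 1 → ¬ ((2 * l : ℕ) : ℤ) ∣ t + 1 →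
      (t : ZMod l) - 1 ≠ 0 ∧ (t : ZMod l) + 1 ≠ 0 := by
    intro t ht hm hp
    have em := (ev ht).2; have ep := (ev ht).1
    rw [one_mul] at em ep
    refine ⟨?_, ?_⟩
    · have := cast_ne_zero_of_not_dvd' (not_dvd_of_not_two_mul_dvd hlodd em hm); push_cast at this; exact this
    · have := cast_ne_zero_of_not_dvd' (not_dvd_of_not_two_mul_dvd hlodd ep hp); push_cast at this; exact this
  obtain ⟨hP2, hP1⟩ := nd hodd₁ hhom₁.1 hhom₁.2
  obtain ⟨hQ2, hQ1⟩ := nd hodd₂ hhom₂.1 hhom₂.2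
  have hU1 : (u₁ : ZMod l) + 1 ≠ 0 := fun h0 ↦ hP1 (by
    have hU : (u₁ : ZMod l) = -1 := by linear_combination h0
    rw [hU] at hUP; linear_combination -hUP)
  have hU2 : (u₁ : ZMod l) - 1 ≠ 0 := fun h0 ↦ hP2 (by
    have hU : (u₁ : ZMod l) = 1 := by linear_combination h0
    rw [hU] at hUP; linear_combination hUP)
  have hV1 : (u₂ : ZMod l) + 1 ≠ 0 := fun h0 ↦ hQ1 (by
    have hV : (u₂ : ZMod l) = -1 := by linear_combination h0
    rw [hV] at hVQ; linear_combination -hVQ)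
  have hV2 : (u₂ : ZMod l) - 1 ≠ 0 := fun h0 ↦ hQ2 (by
    have hV : (u₂ : ZMod l) = 1 := by linear_combination h0
    rw [hV] at hVQ; linear_combination hVQ)
  have hP0 : (p₁ : ZMod l) ≠ 0 := fun h0 ↦ by rw [h0, mul_zero] at hUP; exact zero_ne_one hUP
  have hU0 : (u₁ : ZMod l) ≠ 0 := fun h0 ↦ by rw [h0, zero_mul] at hUP; exact zero_ne_one hUP
  have hQ0 : (p₂ : ZMod l) ≠ 0 := fun h0 ↦ by rw [h0, mul_zero] at hVQ; exact zero_ne_one hVQ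
  have hV0 : (u₂ : ZMod l) ≠ 0 := fun h0 ↦ by rw [h0, zero_mul] at hVQ; exact zero_ne_one hVQ
  have hcne : ∀ {x : ZMod l}, x ≠ 0 → IsUnit (c * x) := fun hx ↦
    isUnit_iff_ne_zero.mpr (mul_ne_zero (inv_ne_zero hl2') hx)
  have key := eq_or_eq_neg_of_cot_relation_smul hl3 h2u hcu hP0 hU0 hQ0 hV0 (hcne hP1) (hcne hP2) (hcne hU1)
    (hcne hU2) (hcne hQ1) (hcne hQ2) (hcne hV1) (hcne hV2) hrel
  -- back to congruences mod `l`, then mod `2l` by parity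
  have par : ∀ {s : ℤ}, Even s → (l : ℤ) ∣ s → ((2 * l : ℕ) : ℤ) ∣ s := fun hs hd ↦
    two_mul_dvd_of_dvd hlodd (even_iff_two_dvd.mp hs) hd
  rcases key with e | e | e | e
  · refine Or.inl (par (hodd₁.sub_odd hodd₂) ((ZMod.intCast_zmod_eq_zero_iff_dvd _ _).mp ?_))
    push_cast; rw [e]; ring
  · refine Or.inr (Or.inl (par (hodd₁.add_odd hodd₂) ((ZMod.intCast_zmod_eq_zero_iff_dvd _ _).mp ?_)))
    push_cast; rw [e]; ring
  · refine Or.inr (Or.inr (Or.inl (par ((hodd₁.mul hodd₂).sub_odd odd_one)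
      ((ZMod.intCast_zmod_eq_zero_iff_dvd _ _).mp ?_))))
    push_cast; rw [e]; linear_combination hUP
  · refine Or.inr (Or.inr (Or.inr (par ((hodd₁.mul hodd₂).add_odd odd_one)
      ((ZMod.intCast_zmod_eq_zero_iff_dvd _ _).mp ?_))))
    push_cast; rw [e]; linear_combination -hUP

/-- **MAIN THEOREM (Ikeda–Yamamoto 1979) for `q = 2l`, `l` an odd prime, general weights.** If `L(2l; p₁, p₂)` and
`L(2l; p₁', p₂')` (all weights prime to `2l`) are isospectral, then `p₁p₂' ≡ ±p₁'p₂` or `p₁p₁' ≡ ±p₂p₂' (mod 2l)`: the two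
lens spaces are isometric (Proposition 1.1; `lensWeightsEquivalent_two_iff`). [cite: IkedaYamamoto1979, Main Theorem
(`q = 2l`), §8, Proposition 1.1] -/
theorem dvd_of_lensMultiplicity_eq_of_twice_prime {l : ℕ} [hl : Fact l.Prime] (hl2 : l ≠ 2) {p₁ p₂ p₁' p₂' : ℤ}
    (hp₁ : IsCoprime p₁ ((2 * l : ℕ) : ℤ)) (hp₂ : IsCoprime p₂ ((2 * l : ℕ) : ℤ)) (hp₁' : IsCoprime p₁' ((2 * l : ℕ) : ℤ))
    (hp₂' : IsCoprime p₂' ((2 * l : ℕ) : ℤ))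
    (h : ∀ n : ℕ, lensMultiplicity (2 * l) p₁ p₂ n = lensMultiplicity (2 * l) p₁' p₂' n) :
    ((2 * l : ℕ) : ℤ) ∣ p₁ * p₂' - p₁' * p₂ ∨ ((2 * l : ℕ) : ℤ) ∣ p₁ * p₂' + p₁' * p₂ ∨
      ((2 * l : ℕ) : ℤ) ∣ p₁ * p₁' - p₂ * p₂' ∨ ((2 * l : ℕ) : ℤ) ∣ p₁ * p₁' + p₂ * p₂' := by
  obtain ⟨u₁, b₁, hub₁⟩ := hp₁
  obtain ⟨u₁', b₁', hub₁'⟩ := hp₁'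
  have hu₁ : ((2 * l : ℕ) : ℤ) ∣ u₁ * p₁ - 1 := ⟨-b₁, by linear_combination hub₁⟩
  have hu₁' : ((2 * l : ℕ) : ℤ) ∣ u₁' * p₁' - 1 := ⟨-b₁', by linear_combination hub₁'⟩
  have hcu₁ : IsCoprime u₁ ((2 * l : ℕ) : ℤ) := ⟨p₁, b₁, by linear_combination hub₁⟩
  have hcu₁' : IsCoprime u₁' ((2 * l : ℕ) : ℤ) := ⟨p₁', b₁', by linear_combination hub₁'⟩
  have hred : ∀ n : ℕ, lensMultiplicity (2 * l) 1 (u₁ * p₂) n = lensMultiplicity (2 * l) 1 (u₁' * p₂') n := fun n ↦ by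
    rw [← lensMultiplicity_eq_one_left (2 * l) hu₁ p₂ n, h n, lensMultiplicity_eq_one_left (2 * l) hu₁' p₂' n]
  have key := dvd_of_lensMultiplicity_one_eq_of_twice_prime hl2 (hcu₁.mul_left hp₂) (hcu₁'.mul_left hp₂') hred
  have eU := cast_mul_cast_eq_one'' hu₁
  have eU' := cast_mul_cast_eq_one'' hu₁'
  have cast0 : ∀ {t : ℤ}, ((2 * l : ℕ) : ℤ) ∣ t → (t : ZMod (2 * l)) = 0 := fun ht ↦
    (ZMod.intCast_zmod_eq_zero_iff_dvd _ _).mpr ht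
  rcases key with e | e | e | e
  · have e' := cast0 e
    push_cast at e'
    refine Or.inl ((ZMod.intCast_zmod_eq_zero_iff_dvd _ _).mp ?_)
    push_cast
    linear_combination (-((p₁ : ZMod (2 * l)) * (p₁' : ZMod (2 * l)))) * e' +
      ((p₁' : ZMod (2 * l)) * (p₂ : ZMod (2 * l))) * eU - ((p₁ : ZMod (2 * l)) * (p₂' : ZMod (2 * l))) * eU'
  · have e' := cast0 e
    push_cast at e'
    refine Or.inr (Or.inl ((ZMod.intCast_zmod_eq_zero_iff_dvd _ _).mp ?_))
    push_cast
    linear_combination ((p₁ : ZMod (2 * l)) * (p₁' : ZMod (2 * l))) * e' -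
      ((p₁' : ZMod (2 * l)) * (p₂ : ZMod (2 * l))) * eU - ((p₁ : ZMod (2 * l)) * (p₂' : ZMod (2 * l))) * eU'
  · have e' := cast0 e
    push_cast at e'
    refine Or.inr (Or.inr (Or.inl ((ZMod.intCast_zmod_eq_zero_iff_dvd _ _).mp ?_)))
    push_cast
    linear_combination (-((p₁ : ZMod (2 * l)) * (p₁' : ZMod (2 * l)))) * e' +
      ((p₂ : ZMod (2 * l)) * (p₂' : ZMod (2 * l)) * (u₁' : ZMod (2 * l)) * (p₁' : ZMod (2 * l))) * eU +
      ((p₂ : ZMod (2 * l)) * (p₂' : ZMod (2 * l))) * eU'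
  · have e' := cast0 e
    push_cast at e'
    refine Or.inr (Or.inr (Or.inr ((ZMod.intCast_zmod_eq_zero_iff_dvd _ _).mp ?_)))
    push_cast
    linear_combination ((p₁ : ZMod (2 * l)) * (p₁' : ZMod (2 * l))) * e' -
      ((p₂ : ZMod (2 * l)) * (p₂' : ZMod (2 * l)) * (u₁' : ZMod (2 * l)) * (p₁' : ZMod (2 * l))) * eU -
      ((p₂ : ZMod (2 * l)) * (p₂' : ZMod (2 * l))) * eU'

/-- **ISOSPECTRAL ⟺ ISOMETRIC for three-dimensional lens spaces with fundamental group of order `2l`, `l` an odd prime.**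
[cite: IkedaYamamoto1979, Main Theorem (`q = 2l`), §8, Proposition 1.1, Proposition 4.1] [cite: Ikeda1980, Theorem 2.1] -/
theorem lensMultiplicity_eq_iff_lensWeightsEquivalent_of_twice_prime {l : ℕ} [hl : Fact l.Prime] (hl2 : l ≠ 2)
    {p₁ p₂ p₁' p₂' : ℤ} (hp₁ : IsCoprime p₁ ((2 * l : ℕ) : ℤ)) (hp₂ : IsCoprime p₂ ((2 * l : ℕ) : ℤ))
    (hp₁' : IsCoprime p₁' ((2 * l : ℕ) : ℤ)) (hp₂' : IsCoprime p₂' ((2 * l : ℕ) : ℤ)) :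
    (∀ n : ℕ, lensMultiplicity (2 * l) p₁ p₂ n = lensMultiplicity (2 * l) p₁' p₂' n) ↔
      LensWeightsEquivalent (2 * l) ![p₁, p₂] ![p₁', p₂'] := by
  constructor
  · intro h
    exact (lensWeightsEquivalent_two_iff hp₁').mpr (dvd_of_lensMultiplicity_eq_of_twice_prime hl2 hp₁ hp₂ hp₁' hp₂' h)
  · intro hE n
    have hc : ∀ i : Fin 2, IsCoprime (![p₁, p₂] i) ((2 * l : ℕ) : ℤ) := fun i ↦ by
      fin_cases i
      · simpa using hp₁
      · simpa using hp₂
    have h0 : 2 * l ≠ 0 := by have := hl.out.pos; omega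
    have := LensWeightsEquivalent.lensSpaceMultiplicity_eq (q := 2 * l) h0 hE hc n
    rwa [lensSpaceMultiplicity_two, lensSpaceMultiplicity_two] at this

/-- **THE MAIN THEOREM OF IKEDA–YAMAMOTO (1979) FOR `q = l` AND `q = 2l`, `l` AN ODD PRIME** ("Main Theorem. Let `q` be a
positive integer. If two 3-dimensional lens spaces with fundamental group of order `q` are isospectral to each other, then
they are isometric to each other." — here for the orders `q ∈ {l, 2l}`, the case `ν = 1` of the families `l^ν`, `2l^ν`
treated in §6 and §8 of the source, and the orders of Tanaka's announcement): for weights prime to `q`, `L(q; p₁, p₂)` and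
`L(q; p₁', p₂')` have the same multiplicities `dim E_{n(n+2)}` for all `n` iff they satisfy Ikeda's isometry criterion
`LensWeightsEquivalent` (Proposition 1.1 / Theorem 2.1 (4) of [Ikeda1980]). [cite: IkedaYamamoto1979, Main Theorem and
Theorem of the Introduction (`q = l, 2l`), §6, §8, Remark of the Introduction] [cite: Ikeda1980, Theorem 2.1] -/
theorem lensMultiplicity_eq_iff_lensWeightsEquivalent_of_prime_or_twice_prime {q l : ℕ} [Fact l.Prime] (hl2 : l ≠ 2)
    (hq : q = l ∨ q = 2 * l) {p₁ p₂ p₁' p₂' : ℤ} (hp₁ : IsCoprime p₁ q) (hp₂ : IsCoprime p₂ q) (hp₁' : IsCoprime p₁' q)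
    (hp₂' : IsCoprime p₂' q) :
    (∀ n : ℕ, lensMultiplicity q p₁ p₂ n = lensMultiplicity q p₁' p₂' n) ↔ LensWeightsEquivalent q ![p₁, p₂] ![p₁', p₂'] := by
  rcases hq with rfl | rfl
  · exact lensMultiplicity_eq_iff_lensWeightsEquivalent_of_prime hl2 hp₁ hp₂ hp₁' hp₂'
  · exact lensMultiplicity_eq_iff_lensWeightsEquivalent_of_twice_prime hl2 hp₁ hp₂ hp₁' hp₂'

end Literature.Analysis.InnerProduct
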